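import Literature.Computability.AlgebraicComplexity.BI17DegreeExponentMonoidProofs
import Literature.Computability.AlgebraicComplexity.BI17PowerSumDegreeProofs
import Literature.Computability.AlgebraicComplexity.Poonen05HypersurfaceLinearAutomorphisms
import HarnessLib

/-!
# The generic ternary quartic has stabilizer period `a(4,3) = 4` and reduced period `a'(4,3) = 1`
# (Bürgisser–Ikenmeyer 2017, Thm. 2.3 / App. Prop. 7.5 (2) at `(D,m) = (4,3)`, AS CORRECTED —
# erratum A21), with the unconditional refutations of the two facts typed verbatim from the print

Theorem-only companion (cell `val-lit`, row BI2017-A; no definitions, no named facts) of the file of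
record `BI17FundamentalInvariantForms.lean`. P. Bürgisser, C. Ikenmeyer, *Fundamental invariants of
orbit closures*, J. Algebra 477 (2017) = arXiv:1511.02927 print, in Thm. 2.3 (main.tex L473–481) and
App. Prop. 7.5 (2) (L2976–2985), the exception "`a'(4,3) = 2`" ("for a generic `w ∈ Sym⁴ℂ³` we have
`stab(w) ≃ C_2`"). The cell's erratum A21 records that this is contradicted by the literature
(generic plane quartics have trivial linear automorphism group [Poonen 2005, Thm. 3], so
`stab(w) = μ₄ · I`, `a(4,3) = 4`, `a'(4,3) = 1`); the tree so far refuted the two verbatim-typed facts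
`BI2017_thm_2_3_period` and `BI2017_prop_A_5` only CONDITIONALLY on the cite-fact `poonen2005_thm_3`
(`not_BI2017_thm_2_3_period_of_poonen2005_thm_3`, `not_BI2017_prop_A_5_of_poonen2005_thm_3`,
`Poonen05HypersurfaceLinearAutomorphisms.lean`).

This file PROVES, without Poonen's theorem, that Zariski-generic ternary quartics have
`det(stab w) = μ₄`, hence `a(w) = 4` and `a'(w) = 1` (`isZariskiGeneric_ternaryQuartic_period`), and
deduces the UNCONDITIONAL refutations `not_BI2017_thm_2_3_period` and `not_BI2017_prop_A_5` of the two
facts as typed (the other printed values are not affected; Poonen's theorem remains the literature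
witness of the stronger statement `stab(w) = μ₄ · I`, which is not proved here).

## Proof (invariant degrees — BI's own Lemma 3.2 (1) mechanism)

* Cayley's invariant `P_{4,3}` (BI eq. (3.5); the tree's `cayleyP 4`) is a NONZERO `SL_3`-invariant of
  degree `3` on `Sym⁴ℂ³` (BI Thm. 3.18 (2), `D = 4` even, `m = 3`: the tree's theorem
  `BI2017_thm_3_18_2`; invariance `tableauInvPoly_mem_slInvariantsOfDegree`).
* A homogeneous `SL_m`-invariant `F` of degree `d` satisfies `F(g · p) = det(g)^{Dd/m} F(p)` (BI proof
  of Lemma 3.2 (1); the tree's `IsSLInvariantCoord.aeval_formCoeff_linSubstRep_eq_det_pow`); here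
  `Dd/m = 4 · 3 / 3 = 4`, so `det(g)^4 = 1` for every `g ∈ stab(p)` once `P_{4,3}(p) ≠ 0`
  (`det_pow_eq_one_of_mem_linStabilizer_of_aeval_ne_zero`, stated for all `D, d, m`).
* The scalar matrices `ζ · 1`, `ζ^4 = 1`, stabilize every quartic and have `det = ζ³`, which runs over
  all of `μ₄` as `ζ` does: `det(stab p) = μ₄` (`stabilizerDetImage_ternaryQuartic_eq_rootsOfUnity`),
  `a(p) = |μ₄| = 4`, `a'(p) = a(p) · gcd(4,3) / 4 = 1`.
* The genericity polynomial is `P_{4,3}` itself. Two contradictory Zariski-generic properties cannot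
  both hold over `ℂ` (`IsZariskiGeneric.false_of_disjoint`, val-lit-x3), whence the refutations of
  the typed clauses "`a'(4,3) = 2`".

Honest framing: bookkeeping of a print-side erratum in the BIP literature programme (classical
invariant theory of ternary quartics); nothing here bears on VP versus VNP.

## References

* [BurgisserIkenmeyer2017] P. Bürgisser, C. Ikenmeyer, J. Algebra 477 (2017) 390–434 =
  arXiv:1511.02927, Thm. 2.3 (main.tex L473–481), App. Prop. 7.5 (2) (L2976–2985), Lemma 3.2 (1),
  eq. (3.5), Thm. 3.18 (2).
* [Poonen2005] B. Poonen, *Varieties without extra automorphisms III: hypersurfaces*, Finite Fields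
  Appl. 11 (2005), Thm. 3 (the literature witness of erratum A21; not used).

## Tree

`stabilizerDetImage`, `mem_stabilizerDetImage_iff`, `stabilizerPeriod`, `stabilizerPeriod_def`,
`reducedStabilizerPeriod`, `IsZariskiGeneric`, `slInvariantsOfDegree`, `mem_slInvariantsOfDegree_iff`,
`cayleyP`, `tableauInvPoly_prodComm`, `BI2017_thm_3_18_2`, `BI2017_thm_2_3_period`, `BI2017_prop_A_5`
(`BI17FundamentalInvariantForms`); `tableauInvPoly_mem_slInvariantsOfDegree` (`BI17PowerSumDegreeProofs`);
`IsSLInvariantCoord.aeval_formCoeff_linSubstRep_eq_det_pow` (`BI17DegreeExponentMonoidProofs`);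
`IsZariskiGeneric.false_of_disjoint` (`Poonen05HypersurfaceLinearAutomorphisms`);
`linSubst_smul_of_isHomogeneous` (`PolystabilityProofs`). Mathlib: `rootsOfUnity`, `mem_rootsOfUnity`,
`Complex.card_rootsOfUnity`, `Matrix.GeneralLinearGroup.mkOfDetNeZero`, `mul_eq_right₀`.
-/

noncomputable section

open MvPolynomial

namespace Literature.Computability.AlgebraicComplexity

/-! ### §1 A nonvanishing `SL_m`-invariant bounds the determinants on the stabilizer -/

section InvariantWeight

/-- **`det(g)^n = 1` on the stabilizer of a form at which an `SL_m`-invariant of degree `d` does not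
vanish** (`D d = m n`): `F(g · p) = det(g)^n F(p)` (BI 2017, proof of Lemma 3.2 (1)) and `g · p = p`.
[cite: BurgisserIkenmeyer2017, Lemma 3.2 (1) (proof)] -/
theorem det_pow_eq_one_of_mem_linStabilizer_of_aeval_ne_zero {m D d n : ℕ} (hm : 0 < m)
    {p : MvPolynomial (Fin m) ℂ} (hp : p.IsHomogeneous D) {F : MvPolynomial (DegIdx (Fin m) D) ℂ}
    (hF : F ∈ slInvariantsOfDegree (Fin m) ℂ D d) (hn : D * d = m * n)
    (hFp : aeval (formCoeff D p) F ≠ 0) {g : GL (Fin m) ℂ} (hg : g ∈ linStabilizer p) :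
    ((Matrix.GeneralLinearGroup.det g : ℂˣ) : ℂ) ^ n = 1 := by
  rw [mem_linStabilizer] at hg
  obtain ⟨hFd, hFi⟩ := (mem_slInvariantsOfDegree_iff D d F).mp hF
  have h := hFi.aeval_formCoeff_linSubstRep_eq_det_pow hm hp hFd hn g
  rw [hg] at h
  exact (mul_eq_right₀ hFp).mp h.symm

/-- Under the same hypotheses, **the image `det(stab p)` lies in the `n`-th roots of unity**.
[cite: BurgisserIkenmeyer2017, Lemma 3.2 (1) (proof)] -/
theorem stabilizerDetImage_le_rootsOfUnity_of_aeval_ne_zero {m D d n : ℕ} (hm : 0 < m)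
    {p : MvPolynomial (Fin m) ℂ} (hp : p.IsHomogeneous D) {F : MvPolynomial (DegIdx (Fin m) D) ℂ}
    (hF : F ∈ slInvariantsOfDegree (Fin m) ℂ D d) (hn : D * d = m * n)
    (hFp : aeval (formCoeff D p) F ≠ 0) : stabilizerDetImage p ≤ rootsOfUnity n ℂ := by
  intro u hu
  obtain ⟨g, hg, rfl⟩ := (mem_stabilizerDetImage_iff p u).mp hu
  rw [mem_rootsOfUnity]
  apply Units.ext
  rw [Units.val_pow_eq_pow_val, Units.val_one]
  exact det_pow_eq_one_of_mem_linStabilizer_of_aeval_ne_zero hm hp hF hn hFp hg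

/-- **Scalar stabilizer elements**: for a form `p` of degree `D` in `m` variables and `ζ^D = 1`, the
scalar matrix `ζ · 1` stabilizes `p`, so `ζ^m ∈ det(stab p)` (BI 2017 §2.1, proof of Lemma 2.1).
[cite: BurgisserIkenmeyer2017, Lemma 2.1 (proof)] -/
theorem pow_mem_stabilizerDetImage_of_pow_eq_one {m D : ℕ} {p : MvPolynomial (Fin m) ℂ}
    (hp : p.IsHomogeneous D) {ζ : ℂˣ} (hζ : ζ ^ D = 1) : ζ ^ m ∈ stabilizerDetImage p := by
  have hdet : Matrix.det (((ζ : ℂ)) • (1 : Matrix (Fin m) (Fin m) ℂ)) = (ζ : ℂ) ^ m := by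
    rw [Matrix.det_smul, Matrix.det_one, mul_one, Fintype.card_fin]
  have hdet0 : Matrix.det (((ζ : ℂ)) • (1 : Matrix (Fin m) (Fin m) ℂ)) ≠ 0 := by
    rw [hdet]; exact pow_ne_zero _ (Units.ne_zero ζ)
  refine (mem_stabilizerDetImage_iff p _).mpr
    ⟨Matrix.GeneralLinearGroup.mkOfDetNeZero _ hdet0, ?_, ?_⟩
  · rw [mem_linStabilizer, linSubstRep_apply, Matrix.GeneralLinearGroup.val_mkOfDetNeZero,
      linSubst_smul_of_isHomogeneous hp, linSubst_one, AlgHom.id_apply, ← Units.val_pow_eq_pow_val,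
      hζ, Units.val_one, one_smul]
  · apply Units.ext
    rw [Matrix.GeneralLinearGroup.val_det_apply, Matrix.GeneralLinearGroup.val_mkOfDetNeZero, hdet,
      Units.val_pow_eq_pow_val]

end InvariantWeight

/-! ### §2 Ternary quartics off `{P_{4,3} = 0}`: `det(stab p) = μ₄`, `a(p) = 4`, `a'(p) = 1` -/

section TernaryQuartic

/-- **Cayley's `P_{4,3}` is an `SL_3`-invariant of degree `3` on ternary quartics** (BI 2017 eq. (3.5),
Thm. 3.11: the tableau polynomial of the row tableau). [cite: BurgisserIkenmeyer2017, eq. (3.5)] -/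
theorem cayleyP_four_three_mem_slInvariantsOfDegree :
    cayleyP (k := ℂ) 4 (Equiv.refl (Fin 3)) ∈ slInvariantsOfDegree (Fin 3) ℂ 4 3 := by
  change tableauInvPoly (k := ℂ) 4 (Equiv.prodComm (Fin 4) (Fin 3)) id ∈ _
  exact tableauInvPoly_mem_slInvariantsOfDegree _

/-- **`P_{4,3} ≠ 0`** (BI 2017 Thm. 3.18 (2): `P_{D,m} ≠ 0` iff `D` is even; `D = 4`, `m = 3`).
[cite: BurgisserIkenmeyer2017, Thm. 3.18(2)] -/
theorem cayleyP_four_three_ne_zero : cayleyP (k := ℂ) 4 (Equiv.refl (Fin 3)) ≠ 0 :=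
  (BI2017_thm_3_18_2 (k := ℂ) (by norm_num : 2 ≤ 3) (by norm_num : 0 < 4) (Equiv.refl (Fin 3))).mpr
    (by decide)

/-- **`det(stab p) = μ₄` for every ternary quartic `p` with `P_{4,3}(p) ≠ 0`**: `⊆` by the weight
`det^{4·3/3} = det⁴` of the degree-`3` invariant `P_{4,3}`, `⊇` by the scalars `ζ · 1`, `ζ^4 = 1`
(`det = ζ³` runs over `μ₄`). This is the corrected content of BI 2017 Thm. 2.3 at `(D,m) = (4,3)`
(erratum A21). [cite: BurgisserIkenmeyer2017, Thm. 2.3] -/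
theorem stabilizerDetImage_ternaryQuartic_eq_rootsOfUnity {p : MvPolynomial (Fin 3) ℂ}
    (hp : p.IsHomogeneous 4) (hP : aeval (formCoeff 4 p) (cayleyP (k := ℂ) 4 (Equiv.refl (Fin 3))) ≠ 0) :
    stabilizerDetImage p = rootsOfUnity 4 ℂ := by
  refine le_antisymm (stabilizerDetImage_le_rootsOfUnity_of_aeval_ne_zero (by norm_num) hp
    cayleyP_four_three_mem_slInvariantsOfDegree (by norm_num) hP) ?_
  intro u hu
  rw [mem_rootsOfUnity] at hu
  -- `u = (u³)³` and `(u³)⁴ = 1`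
  have h9 : (u ^ 3) ^ 3 = u := by
    rw [← pow_mul, show 3 * 3 = 4 * 2 + 1 by norm_num, pow_succ, pow_mul, hu, one_pow, one_mul]
  have h12 : (u ^ 3) ^ 4 = 1 := by
    rw [← pow_mul, show 3 * 4 = 4 * 3 by norm_num, pow_mul, hu, one_pow]
  rw [← h9]
  exact pow_mem_stabilizerDetImage_of_pow_eq_one hp h12

/-- **`a(p) = 4` for every ternary quartic with `P_{4,3}(p) ≠ 0`** (`|μ₄| = 4`).
[cite: BurgisserIkenmeyer2017, Thm. 2.3] -/
theorem stabilizerPeriod_ternaryQuartic_eq_four {p : MvPolynomial (Fin 3) ℂ}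
    (hp : p.IsHomogeneous 4) (hP : aeval (formCoeff 4 p) (cayleyP (k := ℂ) 4 (Equiv.refl (Fin 3))) ≠ 0) :
    stabilizerPeriod p = 4 := by
  rw [stabilizerPeriod_def, stabilizerDetImage_ternaryQuartic_eq_rootsOfUnity hp hP]
  exact Complex.card_rootsOfUnity 4

/-- **`a'(p) = a(p) · gcd(4,3) / 4 = 1` for every ternary quartic with `P_{4,3}(p) ≠ 0`.**
[cite: BurgisserIkenmeyer2017, Thm. 2.3] -/
theorem reducedStabilizerPeriod_ternaryQuartic_eq_one {p : MvPolynomial (Fin 3) ℂ}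
    (hp : p.IsHomogeneous 4) (hP : aeval (formCoeff 4 p) (cayleyP (k := ℂ) 4 (Equiv.refl (Fin 3))) ≠ 0) :
    reducedStabilizerPeriod 4 p = 1 := by
  rw [reducedStabilizerPeriod, stabilizerPeriod_ternaryQuartic_eq_four hp hP, Fintype.card_fin]
  decide

/-- **The generic ternary quartic has `a(4,3) = 4` and `a'(4,3) = 1`** — BI 2017 Thm. 2.3 / App.
Prop. 7.5 (2) at `(D,m) = (4,3)` AS CORRECTED (erratum A21; the print says `a'(4,3) = 2`), PROVED
unconditionally: `IsZariskiGeneric 4` with genericity polynomial `P_{4,3}`.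
[cite: BurgisserIkenmeyer2017, Thm. 2.3] -/
theorem isZariskiGeneric_ternaryQuartic_period :
    IsZariskiGeneric 4 (fun f : MvPolynomial (Fin 3) ℂ =>
      stabilizerPeriod f = 4 ∧ reducedStabilizerPeriod 4 f = 1) :=
  ⟨cayleyP (k := ℂ) 4 (Equiv.refl (Fin 3)), cayleyP_four_three_ne_zero, fun _ hf hPf =>
    ⟨stabilizerPeriod_ternaryQuartic_eq_four hf hPf, reducedStabilizerPeriod_ternaryQuartic_eq_one hf hPf⟩⟩

/-- The corrected `(4,3)` clause of BI 2017 Thm. 2.3 in the shape of the typed fact: almost all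
ternary quartics have `reducedStabilizerPeriod 4 f = 1` (cf. the conditional
`poonen2005_thm_3.isZariskiGeneric_reducedStabilizerPeriod_eq_one`, now unconditional at `(4,3)`).
[cite: BurgisserIkenmeyer2017, Thm. 2.3] -/
theorem isZariskiGeneric_ternaryQuartic_reducedStabilizerPeriod_eq_one :
    IsZariskiGeneric 4 (fun f : MvPolynomial (Fin 3) ℂ => reducedStabilizerPeriod 4 f = 1) :=
  ⟨cayleyP (k := ℂ) 4 (Equiv.refl (Fin 3)), cayleyP_four_three_ne_zero, fun _ hf hPf =>
    reducedStabilizerPeriod_ternaryQuartic_eq_one hf hPf⟩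

end TernaryQuartic

/-! ### §3 Erratum A21: the two verbatim-typed facts are false as typed (unconditionally) -/

section Refutations

/-- **Erratum A21, unconditionally: BI 2017 Thm. 2.3's clause "`a'(4,3) = 2`" is false as printed.**
`BI2017_thm_2_3_period` (typed verbatim) asserts that almost all ternary quartics have `a' = 2`;
`isZariskiGeneric_ternaryQuartic_period` gives `a' = 1` for almost all of them; two contradictory
generic properties cannot both hold over `ℂ` (`IsZariskiGeneric.false_of_disjoint`). (The other
printed values `a'(3,2) = a'(3,3) = 2`, `a'(D,m) = 1` otherwise, are not affected; the conditional
`not_BI2017_thm_2_3_period_of_poonen2005_thm_3` is superseded.) [cite: BurgisserIkenmeyer2017, Thm. 2.3] -/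
theorem not_BI2017_thm_2_3_period : ¬ BI2017_thm_2_3_period := by
  intro h23
  have h2 := h23 4 3 (by norm_num) (by norm_num)
  exact h2.false_of_disjoint isZariskiGeneric_ternaryQuartic_period fun f _ ha hb => by
    rw [hb.2] at ha
    norm_num at ha

/-- **Erratum A21 for BI 2017 App. Prop. 7.5 (2), unconditionally** ("for a generic `w ∈ Sym⁴ℂ³` …
`a'(4,3) = 2`", typed verbatim as the second conjunct of `BI2017_prop_A_5`): false as typed — almost
all ternary quartics have `a' = 1` (`isZariskiGeneric_ternaryQuartic_period`). (Conjuncts 1 and 3 of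
the fact are not affected and not proved here; the conditional
`not_BI2017_prop_A_5_of_poonen2005_thm_3` is superseded.)
[cite: BurgisserIkenmeyer2017, §7 (Appendix) Prop. 7.5 (2)] -/
theorem not_BI2017_prop_A_5 : ¬ BI2017_prop_A_5 := by
  intro hA5
  exact hA5.2.1.false_of_disjoint isZariskiGeneric_ternaryQuartic_period fun f _ ha hb => by
    rw [hb.2] at ha
    norm_num at ha

end Refutations

end Literature.Computability.AlgebraicComplexity

end
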